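import Literature.AlgebraicGeometry.HodgeTheory.FermatHodgeCharacterUGroup
import Summits.HodgeConjecture.HodgeConjecture.Theorems.PadicSemiregularLiftHodgeFermatVarietiesPairedOfLargePrimesNull
import HarnessLib

/-!
# The twin boundary, arithmetic part: kernel cosets as progressions, and the kernels of `(ℤ/5^a7^b)ˣ` — line `cancel-by-any-claim-lattice`, crux `HodgeFermatVarieties` (stmt-HodgeConjecture-1334)

Lead c4's programme T6 (the sextuple twin core `35 ∣ m`). Arithmetic helpers for the twin boundary brick
`…FibreOfBoundaryTwin` (everything PROVED; no named facts, no definitions):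

* `progression_of_kernel_coset` — for `p ∣ N` prime and a unit `y₀` mod `N`: if a property holds at `w y₀` for every
  `w ≡ 1 (mod N/p)`, then it holds at all but at most one of the `p` points `y₀ + j (N/p)` (`j < p`): those points are
  `≡ y₀ (mod N/p)`, and at most one of them is a non-unit (a prime dividing such a point must be `p ∤ N/p`, and then
  `j` is determined mod `p`);
* `apply_kernel_crt` — transport of a kernel-coset statement along `crt : ℤ/(q₀n) ≃ ℤ/q₀ × ℤ/n`: if `T ≠ 0` at
  `crt⁻¹(u y₀, b)` for every `u ≡ 1 (mod q₀/p)`, then `T ≠ 0` at `w · crt⁻¹(y₀, b)` for every `w ≡ 1 (mod q₀n/p)`;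
* the kernels of `q₀ = 5^a 7^b` towards `d₅ = 5^{a−1}7^b` and `d₇ = 5^a7^{b−1}`: `isPrimitive_of_not_factorsThrough_twin`
  (a character mod `q₀` factoring through neither is primitive), `six_le_card_ker_seven` (`#U₇ ≥ 6`),
  `three_le_card_ker_five` (`#U₅ ≥ 3`), `eq_one_of_mem_ker_five_seven` (`U₅ ∩ U₇ = 1`), `mul_ne_neg_one_of_ker`
  (`−1 ∉ U₇U₅` unless `a = b = 1`).

References: [Aoki1983] N. Aoki, Math. Ann. 266 (1983) 23–54, §9 (the level analysis).
-/

-- every sibling file of the line declares into `…CancelByAnyClaimLattice.PairedNull` from a differently named module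
set_option linter.dupNamespace false

noncomputable section
open Finset
open Literature.AlgebraicGeometry.HodgeTheory Literature.AlgebraicGeometry.HodgeTheory.FermatCharacter

namespace Summit.HodgeConjecture.HodgeConjecture.Theorems.CancelByAnyClaimLattice

namespace PairedNull

/-! ### Kernel cosets are progressions with at most one non-unit point -/

/-- **A kernel coset is a progression.** Let `p ∣ N` be prime, `y₀` a unit mod `N`, and suppose `P (w y₀)` for every
unit `w ≡ 1 (mod N/p)`. Then for some `j₀ < p`: `P (y₀ + j (N/p))` for every `j < p`, `j ≠ j₀`. (Each such point is
`≡ y₀ (mod N/p)`; if it is a unit it is `w y₀` with `w` in the kernel; a prime `ℓ ∣ N` dividing a NON-unit point cannot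
divide `N/p` — mod `ℓ` the point is the unit `y₀` — so `ℓ = p ∤ N/p`, and then `y₀ + j(N/p) ≡ 0 (mod p)` determines
`j mod p`: at most one `j < p` gives a non-unit.) [cite: Aoki1983, §9] -/
theorem progression_of_kernel_coset {N : ℕ} [NeZero N] {p : ℕ} (hp : p.Prime) (hpN : p ∣ N) (hd : N / p ∣ N)
    (P : ZMod N → Prop) (y₀ : (ZMod N)ˣ)
    (h : ∀ w : (ZMod N)ˣ, ZMod.unitsMap hd w = 1 → P ((w : ZMod N) * y₀)) :
    ∃ j₀ : ℕ, j₀ < p ∧ ∀ j : ℕ, j < p → j ≠ j₀ → P ((y₀ : ZMod N) + (j : ZMod N) * ((N / p : ℕ) : ZMod N)) := by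
  classical
  have hN0 : N ≠ 0 := NeZero.ne N
  have hd0 : N / p ≠ 0 := (Nat.div_pos (Nat.le_of_dvd (NeZero.pos N) hpN) hp.pos).ne'
  haveI : NeZero (N / p) := ⟨hd0⟩
  haveI : Fact p.Prime := ⟨hp⟩
  set t : ℕ → ZMod N := fun j ↦ (y₀ : ZMod N) + (j : ZMod N) * ((N / p : ℕ) : ZMod N) with ht
  -- every point reduces to `y₀` mod `N/p`
  have hred : ∀ j, ZMod.castHom hd (ZMod (N / p)) (t j) = ZMod.castHom hd (ZMod (N / p)) (y₀ : ZMod N) := by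
    intro j
    rw [ht, map_add, map_mul, map_natCast, map_natCast, ZMod.natCast_self, mul_zero, add_zero]
  -- unit points are kernel translates of `y₀`
  have hunit : ∀ j, IsUnit (t j) → P (t j) := by
    intro j hu
    set w : (ZMod N)ˣ := hu.unit * y₀⁻¹ with hw
    have hwy : (w : ZMod N) * y₀ = t j := by
      rw [hw, Units.val_mul, mul_assoc, Units.inv_mul, mul_one, IsUnit.unit_spec]
    have hker : ZMod.unitsMap hd w = 1 := by
      apply Units.ext
      rw [coe_unitsMap, hw, Units.val_mul, IsUnit.unit_spec, map_mul, hred j, ← map_mul, Units.mul_inv, map_one,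
        Units.val_one]
    rw [← hwy]
    exact h w hker
  -- a non-unit point is divisible by `p`, and then `p ∤ N/p`
  have hnonunit : ∀ j, ¬ IsUnit (t j) → (p : ℕ) ∣ (t j).val ∧ ¬ p ∣ N / p := by
    intro j hnu
    have hncop : ¬ Nat.Coprime (t j).val N := by
      intro hcop
      apply hnu
      rw [← ZMod.natCast_zmod_val (t j)]
      exact (ZMod.isUnit_iff_coprime _ _).mpr hcop
    obtain ⟨ℓ, hℓ, hℓt, hℓN⟩ := Nat.Prime.not_coprime_iff_dvd.mp hncop
    haveI : NeZero ℓ := ⟨hℓ.ne_zero⟩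
    haveI : Fact (1 < ℓ) := ⟨hℓ.one_lt⟩
    have hℓzero : ZMod.castHom hℓN (ZMod ℓ) (t j) = 0 := by
      rw [← ZMod.natCast_zmod_val (t j), map_natCast, ZMod.natCast_eq_zero_iff]
      exact hℓt
    -- `ℓ ∤ N/p`: otherwise `t j ≡ y₀` is a unit mod `ℓ`
    have hℓd : ¬ ℓ ∣ N / p := by
      intro hℓd
      have hcomp : ZMod.castHom hℓN (ZMod ℓ) (t j) = ZMod.castHom hℓd (ZMod ℓ) (ZMod.castHom hd (ZMod (N / p)) (t j)) :=
        (castHom_castHom hd hℓd (t j)).symm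
      rw [hred j, castHom_castHom hd hℓd] at hcomp
      have hu : IsUnit (ZMod.castHom hℓN (ZMod ℓ) (t j)) := by
        rw [hcomp]; exact (Units.isUnit y₀).map _
      rw [hℓzero] at hu
      exact not_isUnit_zero hu
    have hℓp : ℓ = p := by
      have hN : N = p * (N / p) := (Nat.mul_div_cancel' hpN).symm
      rw [hN] at hℓN
      rcases (Nat.Prime.dvd_mul hℓ).mp hℓN with h1 | h1
      · exact (Nat.prime_dvd_prime_iff_eq hℓ hp).mp h1
      · exact absurd h1 hℓd
    subst hℓp
    exact ⟨hℓt, hℓd⟩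
  -- at most one non-unit point
  have huniq : ∀ j j', j < p → j' < p → ¬ IsUnit (t j) → ¬ IsUnit (t j') → j = j' := by
    intro j j' hj hj' hnu hnu'
    obtain ⟨hpt, hpd⟩ := hnonunit j hnu
    obtain ⟨hpt', -⟩ := hnonunit j' hnu'
    have hcast : ∀ i, ZMod.castHom hpN (ZMod p) (t i) =
        ZMod.castHom hpN (ZMod p) (y₀ : ZMod N) + (i : ZMod p) * ((N / p : ℕ) : ZMod p) := by
      intro i; rw [ht, map_add, map_mul, map_natCast, map_natCast]
    have hz : ∀ i, (p : ℕ) ∣ (t i).val → ZMod.castHom hpN (ZMod p) (t i) = 0 := by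
      intro i hi
      rw [← ZMod.natCast_zmod_val (t i), map_natCast, ZMod.natCast_eq_zero_iff]
      exact hi
    have h1 := hz j hpt
    have h2 := hz j' hpt'
    rw [hcast] at h1 h2
    have hdne : ((N / p : ℕ) : ZMod p) ≠ 0 := by
      rw [Ne, ZMod.natCast_eq_zero_iff]; exact hpd
    have hjj : ((j : ZMod p) - (j' : ZMod p)) * ((N / p : ℕ) : ZMod p) = 0 := by linear_combination h1 - h2
    rcases mul_eq_zero.mp hjj with h0 | h0
    · have hval := congrArg ZMod.val (sub_eq_zero.mp h0)
      rwa [ZMod.val_natCast, ZMod.val_natCast, Nat.mod_eq_of_lt hj, Nat.mod_eq_of_lt hj'] at hval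
    · exact absurd h0 hdne
  by_cases hex : ∃ j, j < p ∧ ¬ IsUnit (t j)
  · obtain ⟨j₀, hj₀, hnu₀⟩ := hex
    refine ⟨j₀, hj₀, fun j hj hne ↦ hunit j ?_⟩
    by_contra hnu
    exact hne (huniq j j₀ hj hj₀ hnu hnu₀)
  · push Not at hex
    exact ⟨0, hp.pos, fun j hj _ ↦ hunit j (hex j hj)⟩

/-! ### Transport of kernel cosets along the Chinese remainder map -/

section CRT

variable {q₀ n : ℕ} [NeZero q₀] [NeZero n]

omit [NeZero q₀] [NeZero n] in
/-- **Kernel cosets along `crt`.** Let `p ∣ q₀`, `hc : q₀ ⊥ n`. If `T(crt⁻¹(u y₀, b)) ≠ 0` for every unit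
`u ≡ 1 (mod q₀/p)` of `ℤ/q₀`, then `T(w · crt⁻¹(y₀, b)) ≠ 0` for every unit `w ≡ 1 (mod q₀n/p)` of `ℤ/(q₀ n)`:
such a `w` is `crt⁻¹(u, 1)` with `u ≡ 1 (mod q₀/p)`. [folklore] -/
theorem apply_kernel_crt (hc : q₀.Coprime n) {p : ℕ} (hdq : q₀ / p ∣ q₀) (hdN : q₀ * n / p ∣ q₀ * n)
    (hdd : q₀ / p ∣ q₀ * n / p) (hnd : n ∣ q₀ * n / p)
    (T : ZMod (q₀ * n) → ℂ) (y₀ : (ZMod q₀)ˣ) (b : ZMod n)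
    (h : ∀ u : (ZMod q₀)ˣ, ZMod.unitsMap hdq u = 1 → T ((ZMod.chineseRemainder hc).symm ((u : ZMod q₀) * y₀, b)) ≠ 0)
    (w : (ZMod (q₀ * n))ˣ) (hw : ZMod.unitsMap hdN w = 1) :
    T ((w : ZMod (q₀ * n)) * (ZMod.chineseRemainder hc).symm ((y₀ : ZMod q₀), b)) ≠ 0 := by
  -- the components of `w`
  set u : (ZMod q₀)ˣ := ZMod.unitsMap (dvd_mul_right q₀ n) w with hu
  have hwN : ZMod.castHom hdN (ZMod (q₀ * n / p)) (w : ZMod (q₀ * n)) = 1 := by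
    have := congrArg (fun x : (ZMod (q₀ * n / p))ˣ ↦ (x : ZMod (q₀ * n / p))) hw
    simpa only [coe_unitsMap, Units.val_one] using this
  have hu1 : ZMod.unitsMap hdq u = 1 := by
    apply Units.ext
    rw [coe_unitsMap, hu, coe_unitsMap, castHom_castHom (dvd_mul_right q₀ n) hdq,
      ← castHom_castHom hdN hdd, hwN, map_one, Units.val_one]
  have hwn : ZMod.castHom (dvd_mul_left n q₀) (ZMod n) (w : ZMod (q₀ * n)) = 1 := by
    rw [← castHom_castHom hdN hnd, hwN, map_one]
  have hwq : ZMod.castHom (dvd_mul_right q₀ n) (ZMod q₀) (w : ZMod (q₀ * n)) = (u : ZMod q₀) := by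
    rw [hu, coe_unitsMap]
  -- `w · crt⁻¹(y₀, b) = crt⁻¹(u y₀, b)`
  have hprod : (w : ZMod (q₀ * n)) * (ZMod.chineseRemainder hc).symm ((y₀ : ZMod q₀), b) =
      (ZMod.chineseRemainder hc).symm ((u : ZMod q₀) * y₀, b) := by
    have hw' : (w : ZMod (q₀ * n)) = (ZMod.chineseRemainder hc).symm ((u : ZMod q₀), 1) := by
      have key := crt_symm_castHom hc (w : ZMod (q₀ * n))
      rw [hwq, hwn] at key
      exact key.symm
    rw [hw', ← map_mul, Prod.mk_mul_mk, one_mul]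
  rw [hprod]
  exact h u hu1

end CRT

/-! ### The kernels of `(ℤ/5^a 7^b)ˣ` towards `5^{a-1} 7^b` and `5^a 7^{b-1}` -/

section Kernels

variable {a b : ℕ}

/-- A proper divisor of `5^a 7^b` divides `5^{a-1} 7^b` or `5^a 7^{b-1}`. [folklore] -/
theorem dvd_or_dvd_of_dvd_twin (ha : 1 ≤ a) (hb : 1 ≤ b) {c : ℕ} (hc : c ∣ 5 ^ a * 7 ^ b)
    (hne : c ≠ 5 ^ a * 7 ^ b) : c ∣ 5 ^ (a - 1) * 7 ^ b ∨ c ∣ 5 ^ a * 7 ^ (b - 1) := by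
  have hcop : (5 ^ a).Coprime (7 ^ b) := Nat.Coprime.pow _ _ (by norm_num)
  have hsplit : c = Nat.gcd c (5 ^ a) * Nat.gcd c (7 ^ b) := by
    rw [← Nat.Coprime.gcd_mul c hcop, Nat.gcd_eq_left hc]
  obtain ⟨i, hi, hci⟩ := (Nat.dvd_prime_pow Nat.prime_five).mp (Nat.gcd_dvd_right c (5 ^ a))
  obtain ⟨j, hj, hcj⟩ := (Nat.dvd_prime_pow (by decide : Nat.Prime 7)).mp (Nat.gcd_dvd_right c (7 ^ b))
  rw [hci, hcj] at hsplit
  have hij : ¬ (i = a ∧ j = b) := by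
    rintro ⟨rfl, rfl⟩; exact hne hsplit
  rcases Nat.lt_or_ge i a with hia | hia
  · left
    rw [hsplit]
    exact Nat.mul_dvd_mul (pow_dvd_pow 5 (by omega)) (pow_dvd_pow 7 hj)
  · right
    have hia' : i = a := le_antisymm hi hia
    have hjb : j < b := by
      rcases Nat.lt_or_ge j b with h | h
      · exact h
      · exact absurd ⟨hia', le_antisymm hj h⟩ hij
    rw [hsplit]
    exact Nat.mul_dvd_mul (pow_dvd_pow 5 hi) (pow_dvd_pow 7 (by omega))

/-- **A character mod `5^a 7^b` factoring through neither `5^{a-1}7^b` nor `5^a7^{b-1}` is primitive.** [folklore] -/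
theorem isPrimitive_of_not_factorsThrough_twin (ha : 1 ≤ a) (hb : 1 ≤ b)
    [NeZero (5 ^ a * 7 ^ b)] (χ : DirichletCharacter ℂ (5 ^ a * 7 ^ b))
    (h5 : ¬ χ.FactorsThrough (5 ^ (a - 1) * 7 ^ b)) (h7 : ¬ χ.FactorsThrough (5 ^ a * 7 ^ (b - 1))) :
    χ.IsPrimitive := by
  by_contra hnp
  rw [DirichletCharacter.isPrimitive_def] at hnp
  have hfc := χ.factorsThrough_conductor
  rcases dvd_or_dvd_of_dvd_twin ha hb χ.conductor_dvd_level hnp with h | h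
  · exact h5 (DirichletCharacter.FactorsThrough.mono (χ := χ) hfc h
      (Nat.mul_dvd_mul (pow_dvd_pow 5 (Nat.sub_le a 1)) dvd_rfl))
  · exact h7 (DirichletCharacter.FactorsThrough.mono (χ := χ) hfc h
      (Nat.mul_dvd_mul dvd_rfl (pow_dvd_pow 7 (Nat.sub_le b 1))))

/-- `#ker((ℤ/5^a7^b)ˣ → (ℤ/5^a7^{b-1})ˣ) ≥ 6` (it is `6` if `b = 1` and `7` otherwise). [folklore] -/
theorem six_le_card_ker_seven (ha : 1 ≤ a) (hb : 1 ≤ b) [NeZero (5 ^ a * 7 ^ b)]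
    (hd₇ : 5 ^ a * 7 ^ (b - 1) ∣ 5 ^ a * 7 ^ b) :
    6 ≤ #(univ.filter fun v : (ZMod (5 ^ a * 7 ^ b))ˣ ↦ ZMod.unitsMap hd₇ v = 1) := by
  classical
  have h := totient_mul_card_ker (q := 5 ^ a * 7 ^ b) hd₇
  set K := #(univ.filter fun v : (ZMod (5 ^ a * 7 ^ b))ˣ ↦ ZMod.unitsMap hd₇ v = 1)
  have h57 : ∀ i j : ℕ, (5 ^ i).Coprime (7 ^ j) := fun i j ↦ Nat.Coprime.pow _ _ (by norm_num)
  rw [Nat.totient_mul (h57 _ _), Nat.totient_mul (h57 _ _), Nat.totient_prime_pow Nat.prime_five ha,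
    Nat.totient_prime_pow (by decide : Nat.Prime 7) hb] at h
  have h5pos : 0 < 5 ^ (a - 1) * (5 - 1) := by positivity
  rcases Nat.lt_or_ge b 2 with hb1 | hb2
  · have hb' : b = 1 := by omega
    subst hb'
    simp only [Nat.sub_self, pow_zero, Nat.totient_one, mul_one] at h
    have : K = 6 := by
      have h' : 5 ^ (1 - 1 + (a - 1)) * (5 - 1) * K = 5 ^ (a - 1) * (5 - 1) * (1 * (7 - 1)) := by
        simpa using h
      have := Nat.eq_of_mul_eq_mul_left h5pos (by simpa using h')
      omega
    omega
  · rw [Nat.totient_prime_pow (by decide : Nat.Prime 7) (by omega)] at h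
    have h7 : 7 ^ (b - 1) * (7 - 1) = 7 * (7 ^ (b - 1 - 1) * (7 - 1)) := by
      rw [← mul_assoc, ← pow_succ']; congr 2; omega
    rw [h7] at h
    have hpos : 0 < 5 ^ (a - 1) * (5 - 1) * (7 ^ (b - 1 - 1) * (7 - 1)) := by positivity
    have hK : K = 7 := by
      apply Nat.eq_of_mul_eq_mul_left hpos
      linarith [h]
    omega

/-- `#ker((ℤ/5^a7^b)ˣ → (ℤ/5^{a-1}7^b)ˣ) ≥ 3` (it is `4` if `a = 1` and `5` otherwise). [folklore] -/
theorem three_le_card_ker_five (ha : 1 ≤ a) (hb : 1 ≤ b) [NeZero (5 ^ a * 7 ^ b)]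
    (hd₅ : 5 ^ (a - 1) * 7 ^ b ∣ 5 ^ a * 7 ^ b) :
    3 ≤ #(univ.filter fun u : (ZMod (5 ^ a * 7 ^ b))ˣ ↦ ZMod.unitsMap hd₅ u = 1) := by
  classical
  have h := totient_mul_card_ker (q := 5 ^ a * 7 ^ b) hd₅
  set K := #(univ.filter fun u : (ZMod (5 ^ a * 7 ^ b))ˣ ↦ ZMod.unitsMap hd₅ u = 1)
  have h57 : ∀ i j : ℕ, (5 ^ i).Coprime (7 ^ j) := fun i j ↦ Nat.Coprime.pow _ _ (by norm_num)
  rw [Nat.totient_mul (h57 _ _), Nat.totient_mul (h57 _ _), Nat.totient_prime_pow (by decide : Nat.Prime 7) hb,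
    Nat.totient_prime_pow Nat.prime_five ha] at h
  have h7pos : 0 < 7 ^ (b - 1) * (7 - 1) := by positivity
  rcases Nat.lt_or_ge a 2 with ha1 | ha2
  · have ha' : a = 1 := by omega
    subst ha'
    simp only [Nat.sub_self, pow_zero, Nat.totient_one, one_mul] at h
    have hK : K = 4 := by
      apply Nat.eq_of_mul_eq_mul_left h7pos
      linarith [h]
    omega
  · rw [Nat.totient_prime_pow Nat.prime_five (by omega)] at h
    have h5 : 5 ^ (a - 1) * (5 - 1) = 5 * (5 ^ (a - 1 - 1) * (5 - 1)) := by
      rw [← mul_assoc, ← pow_succ']; congr 2; omega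
    rw [h5] at h
    have hpos : 0 < 5 ^ (a - 1 - 1) * (5 - 1) * (7 ^ (b - 1) * (7 - 1)) := by positivity
    have hK : K = 5 := by
      apply Nat.eq_of_mul_eq_mul_left hpos
      linarith [h]
    omega

/-- The value of a kernel element minus one is divisible by the target level. [folklore] -/
theorem dvd_val_sub_one_of_unitsMap_eq_one {q d : ℕ} [NeZero q] (hd : d ∣ q) {w : (ZMod q)ˣ}
    (hw : ZMod.unitsMap hd w = 1) : d ∣ ((w : ZMod q) - 1).val := by
  have h1 : ZMod.castHom hd (ZMod d) ((w : ZMod q) - 1) = 0 := by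
    rw [map_sub, ← coe_unitsMap, hw, Units.val_one, map_one, sub_self]
  rw [← ZMod.natCast_zmod_val ((w : ZMod q) - 1), map_natCast, ZMod.natCast_eq_zero_iff] at h1
  exact h1

/-- **The two kernels meet trivially**: `w ≡ 1 (mod 5^{a-1}7^b)` and `w ≡ 1 (mod 5^a7^{b-1})` force `w = 1`
in `(ℤ/5^a7^b)ˣ`. [folklore] -/
theorem eq_one_of_mem_ker_five_seven [NeZero (5 ^ a * 7 ^ b)]
    (hd₅ : 5 ^ (a - 1) * 7 ^ b ∣ 5 ^ a * 7 ^ b) (hd₇ : 5 ^ a * 7 ^ (b - 1) ∣ 5 ^ a * 7 ^ b)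
    (w : (ZMod (5 ^ a * 7 ^ b))ˣ) (h5 : ZMod.unitsMap hd₅ w = 1) (h7 : ZMod.unitsMap hd₇ w = 1) : w = 1 := by
  have d1 := dvd_val_sub_one_of_unitsMap_eq_one hd₅ h5
  have d2 := dvd_val_sub_one_of_unitsMap_eq_one hd₇ h7
  have h7b : 7 ^ b ∣ ((w : ZMod (5 ^ a * 7 ^ b)) - 1).val := (dvd_mul_left _ _).trans d1
  have h5a : 5 ^ a ∣ ((w : ZMod (5 ^ a * 7 ^ b)) - 1).val := (dvd_mul_right _ _).trans d2
  have hq : 5 ^ a * 7 ^ b ∣ ((w : ZMod (5 ^ a * 7 ^ b)) - 1).val :=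
    Nat.Coprime.mul_dvd_of_dvd_of_dvd (Nat.Coprime.pow _ _ (by norm_num)) h5a h7b
  have hzero : ((w : ZMod (5 ^ a * 7 ^ b)) - 1) = 0 := by
    rw [← ZMod.natCast_zmod_val ((w : ZMod (5 ^ a * 7 ^ b)) - 1), ZMod.natCast_eq_zero_iff]
    exact hq
  exact Units.ext (sub_eq_zero.mp hzero)

/-- **`-1 ∉ U₇ · U₅` unless `a = b = 1`**: if `u ≡ 1 (mod 5^{a-1}7^b)`, `v ≡ 1 (mod 5^a7^{b-1})` and `v u = -1`, then
mod `5^{a-1}7^{b-1}` we get `-1 ≡ 1`, so `5^{a-1}7^{b-1} ∣ 2`, i.e. `a = b = 1`. [folklore] -/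
theorem mul_ne_neg_one_of_ker (ha : 1 ≤ a) (hb : 1 ≤ b) (hab : ¬ (a = 1 ∧ b = 1)) [NeZero (5 ^ a * 7 ^ b)]
    (hd₅ : 5 ^ (a - 1) * 7 ^ b ∣ 5 ^ a * 7 ^ b) (hd₇ : 5 ^ a * 7 ^ (b - 1) ∣ 5 ^ a * 7 ^ b)
    (u v : (ZMod (5 ^ a * 7 ^ b))ˣ) (hu : ZMod.unitsMap hd₅ u = 1) (hv : ZMod.unitsMap hd₇ v = 1) :
    v * u ≠ -1 := by
  intro hvu
  set g : ℕ := 5 ^ (a - 1) * 7 ^ (b - 1) with hg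
  have hg5 : g ∣ 5 ^ (a - 1) * 7 ^ b := Nat.mul_dvd_mul dvd_rfl (pow_dvd_pow 7 (Nat.sub_le b 1))
  have hg7 : g ∣ 5 ^ a * 7 ^ (b - 1) := Nat.mul_dvd_mul (pow_dvd_pow 5 (Nat.sub_le a 1)) dvd_rfl
  have hgq : g ∣ 5 ^ a * 7 ^ b := hg5.trans hd₅
  haveI : NeZero g := ⟨by positivity⟩
  -- mod `g`: `u ≡ 1`, `v ≡ 1`, hence `-1 ≡ 1`
  have hu1 : ZMod.castHom hgq (ZMod g) (u : ZMod (5 ^ a * 7 ^ b)) = 1 := by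
    rw [← castHom_castHom hd₅ hg5, ← coe_unitsMap, hu, Units.val_one, map_one]
  have hv1 : ZMod.castHom hgq (ZMod g) (v : ZMod (5 ^ a * 7 ^ b)) = 1 := by
    rw [← castHom_castHom hd₇ hg7, ← coe_unitsMap, hv, Units.val_one, map_one]
  have hm : ZMod.castHom hgq (ZMod g) (((v * u : (ZMod (5 ^ a * 7 ^ b))ˣ)) : ZMod (5 ^ a * 7 ^ b)) = -1 := by
    rw [hvu, Units.val_neg, Units.val_one, map_neg, map_one]
  rw [Units.val_mul, map_mul, hu1, hv1, mul_one] at hm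
  -- `2 = 0` in `ℤ/g`, so `g ∣ 2`; `g` is odd, so `g = 1`
  have h2 : ((2 : ℕ) : ZMod g) = 0 := by
    have : (1 : ZMod g) + 1 = 0 := by nth_rewrite 1 [hm]; ring
    exact_mod_cast this
  rw [ZMod.natCast_eq_zero_iff] at h2
  have hg2 : g ≤ 2 := Nat.le_of_dvd two_pos h2
  have hgodd : ¬ 2 ∣ g := by
    rw [hg]
    intro h
    rcases (Nat.Prime.dvd_mul Nat.prime_two).mp h with h | h
    · exact absurd (Nat.Prime.dvd_of_dvd_pow Nat.prime_two h) (by norm_num)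
    · exact absurd (Nat.Prime.dvd_of_dvd_pow Nat.prime_two h) (by norm_num)
  have hg1 : g = 1 := by
    rcases h2 with ⟨k, hk⟩
    interval_cases g
    · exact absurd (NeZero.ne (0 : ℕ)) (by simp)
    · rfl
    · exact absurd (dvd_refl 2) hgodd
  -- `g = 1` forces `a = b = 1`
  apply hab
  rw [hg] at hg1
  have h5 : 5 ^ (a - 1) = 1 := Nat.eq_one_of_mul_eq_one_right hg1
  have h7 : 7 ^ (b - 1) = 1 := Nat.eq_one_of_mul_eq_one_left hg1
  have ha0 : a - 1 = 0 := by
    rcases Nat.pow_eq_one.mp h5 with h | h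
    · norm_num at h
    · exact h
  have hb0 : b - 1 = 0 := by
    rcases Nat.pow_eq_one.mp h7 with h | h
    · norm_num at h
    · exact h
  omega

end Kernels

/-- **Registered form of `progression_of_kernel_coset`** (a kernel coset is a progression with at most one non-unit
point). [cite: Aoki1983, §9] -/
theorem stub_progression_of_kernel_coset : ∀ {N : ℕ} [NeZero N] {p : ℕ}, p.Prime → p ∣ N → ∀ (hd : N / p ∣ N) (P : ZMod N → Prop) (y₀ : (ZMod N)ˣ), (∀ w : (ZMod N)ˣ, ZMod.unitsMap hd w = 1 → P ((w : ZMod N) * y₀)) → ∃ j₀ : ℕ, j₀ < p ∧ ∀ j : ℕ, j < p → j ≠ j₀ → P ((y₀ : ZMod N) + (j : ZMod N) * ((N / p : ℕ) : ZMod N)) :=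
  fun hp hpN hd P y₀ h ↦ progression_of_kernel_coset hp hpN hd P y₀ h

end PairedNull

end Summit.HodgeConjecture.HodgeConjecture.Theorems.CancelByAnyClaimLattice
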